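import Summits.Ventures.YMGap.Thresholds.StarLimitClustering
import Summits.Ventures.YMGap.Thresholds.StarTransferZd
import Summits.Ventures.YMGap.Thresholds.SharpClusteringLimitPrep
import HarnessLib

/-!
# Venture YMGap — track (c) «DS» in GENERAL DIMENSION `d`: the consumer chain of the star door —
# star windows on all large tori `(ℤ/L)^d` ⇒ `MassGapAt d N x` (DLR uniqueness on `ℤ^d` + the
# Shen–Zhu–Zhu covariance clause for every DLR state), every `SU(N)`, every `d`

HONEST FRAMING: venture file (cell `pub-ymgap`, QuantumFields programme; seat ds-1), strong-coupling LATTICE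
statements for `SU(N)` lattice Yang–Mills on `ℤ^d` with the Wilson action (tree coupling `β = N·x`, 't Hooft
coupling `x`); nothing about the continuum, confinement at weak coupling, or the Millennium problem.  This is
the general-`d` form of this seat's `StarLimitSUN` / `StarMassGapSUN` (written over `Site 4 L`, `LGConfig 4`):
the statements and proofs are the same with `d` a variable and the Dobrushin–Shlosman rate of the tree door
`DSWindow.star_abs_covariance_le` kept in its printed any-`d` form `κ_d(ρ) = (1 − ρ)²/(2(2ρ·2d + 1))`
(`N⋆ = 2d` star windows contain a given link; `d = 4`: `(1 − ρ)²/(2(16ρ + 1)) = DSWindow.starRate ρ`).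

INPUT (a HYPOTHESIS, never asserted here): for every torus side `L ≥ L₁` a vertex-indexed influence array
`Kw : Site d L → Edge d L → Edge d L → ℝ` for the STAR windows of the `SU(N)` torus Wilson plaquette-weight
specification at tree coupling `β` — the four clauses (nonnegative; supported on boundary links within periodic
sup-distance `1` of the star vertex; the window contraction (H1) `IsLinkWindowContraction … suFrobDist starWin`;
per-star received sums `≤ ρ`) with ONE `ρ < 1`.  At `d = 4` the tree supplies it for every `N`
(`StarLemmaGSUN.star_window_of_oneLinkKRModulus`, ds-4's Lemma G); in general `d` it is the output of the
cell's general-`d` Lemma G (seat ds-4, PLAN R134, files `StarResolventDim` → … → `StarWindowBoundDim`), with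
`ρ = R_G^{(d)}(c) = (2d−2)c(1+c)/(1 − (2d−4)c − (2d−2)c²)`.

OUTPUT (kernel theorems, every `d`, every `N`):
* `star_torus_cov_lipschitz` — one torus: `|cov(F₁∘lift, F₂∘lift)| ≤ 4(2√N)² e^{−κ_d(ρ)(m−2)} (#Λ₁K₁)(#Λ₂K₂)`
  for Lipschitz cylinder functions of `ℤ^d` read through the periodic lift;
* `star_limitState_clustering` — the covariance clause of `Summit.Ventures.YMGap.MassGapAt d N` for every
  infinite-volume limit state (weak limits along tori, `StarLimit.abs_cov_le_of_eventually_torus`);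
* `star_massGapAt_of_unique` — `MassGapAt d N x` from the windows plus DLR uniqueness;
* `star_massGapAt_of_windows` — `MassGapAt d N x` from the windows ALONE: uniqueness is this seat's any-`d`
  `ℤ^d` door `DSWindowZd.hasUniqueGibbsMeasure_of_isLinkWindowContraction` (p329551) on one torus of side `≥ 5`;
* `star_hasUniqueInfiniteVolumeLimit_of_windows` — the full sequence of torus states converges (OS78 §4 currency).

So every general-`d` window row becomes a `MassGapAt d N` / `ImprovedThreshold d N` row in a few lines
(sibling rows file).  No rate is claimed beyond `∃ c > 0`.  References: Dobrushin–Shlosman (1985) `C_V`;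
Föllmer, LNM 1362 (1988) Ch. I; Shen–Zhu–Zhu, CMP 400 (2023) (shape of the clustering clause).
-/

noncomputable section

open MeasureTheory ProbabilityTheory Function Finset Filter Topology
open scoped NNReal
open Literature.Probability.LatticeModels
open Literature.Probability.LatticeModels.DobrushinMetric
open Literature.MathematicalPhysics.QuantumLattice (toTorusObservable toTorusObservable_apply IsCylinder
  LGConfig torusLift torusEdge fundamentalRep infiniteVolumeLimitPoints IsInfiniteVolumeLimitAlong
  ymSpecification ymGibbsMeasures continuous_fundamentalRep HasUniqueInfiniteVolumeLimit
  mem_ymGibbsMeasures_of_mem_infiniteVolumeLimitPoints_holds infiniteVolumeLimitPoints_nonempty_holds)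
open Literature.MathematicalPhysics.QuantumFieldTheory
open Literature.MathematicalPhysics.QuantumFieldTheory.Balaban1983to89
open Literature.MathematicalPhysics.QuantumFieldTheory.Balaban1983to89.StrongCouplingTorusWindow
open Summit.Ventures.YMGap.DSWindow
open Summit.Ventures.YMGap.StarLimit (abs_cov_le_of_eventually_torus continuous_of_isLipschitzCylinder
  linkObs_toTorusObservable)
open Summit.Ventures.YMGap.SharpClustering (setDistEdges_le_supNorm_of_mem)

namespace Summit.Ventures.YMGap.StarDimLimit

variable {d N : ℕ}

/-- The any-`d` Dobrushin–Shlosman rate of the star door, `κ_d(ρ) = (1 − ρ)²/(2(2ρ·2d + 1))`, is positive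
for `0 ≤ ρ < 1`. [folklore] -/
theorem dimRate_pos {ρ : ℝ} (hρ0 : 0 ≤ ρ) (hρ1 : ρ < 1) :
    0 < (1 - ρ) ^ 2 / (2 * (2 * ρ * ((2 * d : ℕ) : ℝ) + 1)) := by
  have h2 : 0 ≤ 2 * ρ * ((2 * d : ℕ) : ℝ) := mul_nonneg (mul_nonneg zero_le_two hρ0) (Nat.cast_nonneg _)
  exact div_pos (pow_pos (sub_pos.2 hρ1) 2) (by linarith)

/-! ### One torus: the star door for Lipschitz cylinder functions of `ℤ^d`, `SU(N)` -/

section Torus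

variable {L : ℕ} [NeZero L]

/-- **Torus covariance bound for two Lipschitz cylinder functions of `ℤ^d` read through the periodic
lift** (`SU(N)`, any `d`, tree coupling `β`): given a vertex-indexed influence array for the star windows of
the torus Wilson specification (nonnegative, supported within sup-distance `1` of the centre, (H1), per-star
received sums `≤ ρ < 1`), if `torusEdge L` is injective on each support and the projected base points of
`Λ₁`, `Λ₂` are `≥ m` apart in the periodic sup-distance, then under the torus Wilson measure
`|cov(F₁∘lift, F₂∘lift)| ≤ 4(2√N)² e^{−κ_d(ρ)(m − 2)} (#Λ₁ K₁)(#Λ₂ K₂)` (`DSWindow.star_abs_covariance_le`,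
`N⋆ = 2d`).  General-`d` form of `StarSUNLimit.star_torus_cov_lipschitz`. [folklore] -/
theorem star_torus_cov_lipschitz (β : ℝ) {ρ : ℝ} (hρ0 : 0 ≤ ρ) (hρ1 : ρ < 1)
    {Kw : Site d L → Edge d L → Edge d L → ℝ} (hKw : ∀ s y x, 0 ≤ Kw s y x)
    (hKloc : ∀ s y x, Kw s y x ≠ 0 → ∀ w ∈ linkEnds y, torusNorm (s - w) ≤ 1)
    (hH1 : IsLinkWindowContraction (d := d) (L := L) (wilsonPlaqWeight N β) suFrobDist starWin
      fun c => Kw c.1)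
    (hsum : ∀ (s : Site d L) (x : Edge d L), x ∈ vertexStar s → ∑ y, Kw s y x ≤ ρ)
    {F₁ F₂ : LGConfig d (Matrix.specialUnitaryGroup (Fin N) ℂ) → ℝ}
    {Λ₁ Λ₂ : Finset (Literature.MathematicalPhysics.QuantumLattice.ZdEdge d)} {K₁ K₂ : ℝ≥0}
    (hF₁ : IsLipschitzCylinder (fundamentalRep (Fin N)) F₁ Λ₁ K₁)
    (hF₂ : IsLipschitzCylinder (fundamentalRep (Fin N)) F₂ Λ₂ K₂)
    (hinj₁ : ∀ e ∈ Λ₁, ∀ e' ∈ Λ₁, torusEdge L e = torusEdge L e' → e = e')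
    (hinj₂ : ∀ e ∈ Λ₂, ∀ e' ∈ Λ₂, torusEdge L e = torusEdge L e' → e = e') {m : ℕ}
    (hgeom : ∀ a ∈ Λ₁, ∀ b ∈ Λ₂, m ≤ torusNorm ((torusEdge L a).1 - (torusEdge L b).1)) :
    |cov[toTorusObservable L F₁, toTorusObservable L F₂;
        wilsonMeasure (d := d) (L := L) (fundamentalRep (Fin N)) β]| ≤
      4 * (2 * Real.sqrt N) ^ 2 *
        Real.exp (-((1 - ρ) ^ 2 / (2 * (2 * ρ * ((2 * d : ℕ) : ℝ) + 1)) * ((m - 2 : ℕ) : ℝ))) *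
        ((Λ₁.card : ℝ) * K₁) * ((Λ₂.card : ℝ) * K₂) := by
  classical
  haveI : SecondCountableTopology (Matrix (Fin N) (Fin N) ℂ) :=
    inferInstanceAs (SecondCountableTopology (Fin N → Fin N → ℂ))
  haveI : SecondCountableTopology (Matrix.specialUnitaryGroup (Fin N) ℂ) :=
    Topology.IsEmbedding.subtypeVal.secondCountableTopology
  have hfo := linkObs_toTorusObservable (L := L) hF₁ hinj₁
  have hgo := linkObs_toTorusObservable (L := L) hF₂ hinj₂
  have hL₀ : ∀ x ∈ Λ₁.image (torusEdge L), ∀ z ∈ Λ₂.image (torusEdge L),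
      ∀ a ∈ linkEnds x, ∀ w ∈ linkEnds z, m - 2 ≤ torusNorm (a - w) := by
    intro x hx z hz a ha w hw
    obtain ⟨a₁, ha₁, rfl⟩ := Finset.mem_image.1 hx
    obtain ⟨b₁, hb₁, rfl⟩ := Finset.mem_image.1 hz
    have h2 := hgeom a₁ ha₁ b₁ hb₁
    have htri : torusNorm ((torusEdge L a₁).1 - (torusEdge L b₁).1) ≤ 1 + torusNorm (a - w) + 1 := by
      calc torusNorm ((torusEdge L a₁).1 - (torusEdge L b₁).1)
          ≤ torusNorm ((torusEdge L a₁).1 - a) + torusNorm (a - (torusEdge L b₁).1) :=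
            torusNorm_sub_le _ _ _
        _ ≤ torusNorm ((torusEdge L a₁).1 - a) +
              (torusNorm (a - w) + torusNorm (w - (torusEdge L b₁).1)) :=
            Nat.add_le_add_left (torusNorm_sub_le _ _ _) _
        _ ≤ 1 + (torusNorm (a - w) + 1) := by
            refine Nat.add_le_add (torusNorm_fst_sub_linkEnds_le_one _ ha) (Nat.add_le_add_left ?_ _)
            rw [← torusNorm_neg, neg_sub]; exact torusNorm_fst_sub_linkEnds_le_one _ hw
        _ = 1 + torusNorm (a - w) + 1 := by ring
    omega
  have hR2 : (0 : ℝ) ≤ 2 * Real.sqrt N := by positivity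
  have key := star_abs_covariance_le (continuous_wilsonPlaqWeight (N := N) β)
    (wilsonPlaqWeight_pos (N := N) β) hR2 suFrobDist_le hKw hKloc hH1 hρ0 hρ1 hsum hfo hgo (m - 2) hL₀
  rw [← wilsonMeasure_eq_groupHeatKernelMeasure] at key
  refine key.trans ?_
  rw [Finset.sum_const, Finset.sum_const, nsmul_eq_mul, nsmul_eq_mul]
  have hK₁ : (0 : ℝ) ≤ K₁ := K₁.2
  have hK₂ : (0 : ℝ) ≤ K₂ := K₂.2
  have hc₁ : ((Λ₁.image (torusEdge L)).card : ℝ) ≤ Λ₁.card := by exact_mod_cast Finset.card_image_le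
  have hc₂ : ((Λ₂.image (torusEdge L)).card : ℝ) ≤ Λ₂.card := by exact_mod_cast Finset.card_image_le
  have hP : 0 ≤ 4 * (2 * Real.sqrt N) ^ 2 *
      Real.exp (-((1 - ρ) ^ 2 / (2 * (2 * ρ * ((2 * d : ℕ) : ℝ) + 1)) * ((m - 2 : ℕ) : ℝ))) := by
    positivity
  have hA : ((Λ₁.image (torusEdge L)).card : ℝ) * K₁ ≤ (Λ₁.card : ℝ) * K₁ :=
    mul_le_mul_of_nonneg_right hc₁ hK₁
  have hB : ((Λ₂.image (torusEdge L)).card : ℝ) * K₂ ≤ (Λ₂.card : ℝ) * K₂ :=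
    mul_le_mul_of_nonneg_right hc₂ hK₂
  have hB0 : 0 ≤ ((Λ₂.image (torusEdge L)).card : ℝ) * K₂ := by positivity
  have hA1 : 0 ≤ (Λ₁.card : ℝ) * K₁ := by positivity
  exact mul_le_mul (mul_le_mul_of_nonneg_left hA hP) hB hB0 (mul_nonneg hP hA1)

end Torus

/-! ### The Shen–Zhu–Zhu-shaped clustering clause for limit states, `SU(N)`, any `d` -/

section Limit

/-- **The Shen–Zhu–Zhu-shaped clustering clause for every infinite-volume limit state, from star windows
on all large tori** (`SU(N)`, any `d`, tree coupling `β`): if every torus of side `L ≥ L₁` carries a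
vertex-indexed influence array for the star windows (the four clauses) with one `ρ < 1`, then for every limit
state `μ ∈ infiniteVolumeLimitPoints (fundamentalRep (Fin N)) β` and every `n`, with
`c₁ = 4(2√N)² n² e^{3κ_d(ρ)}`: for all Lipschitz cylinder functions `F₁, F₂` with supports of size `≤ n`,
`|cov_μ(F₁, F₂)| ≤ c₁ e^{−κ_d(ρ) d(Λ₁,Λ₂)} (K₁K₂ + ‖F₁‖₂‖F₂‖₂)` — literally the covariance clause of
`Summit.Ventures.YMGap.MassGapAt d N` at this coupling, for limit states.  General-`d` form of
`StarSUNLimit.star_limitState_clustering`. [folklore] -/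
theorem star_limitState_clustering (β : ℝ) {ρ : ℝ} (hρ0 : 0 ≤ ρ) (hρ1 : ρ < 1) (L₁ : ℕ)
    (hW : ∀ (L : ℕ) [NeZero L], L₁ ≤ L → ∃ Kw : Site d L → Edge d L → Edge d L → ℝ,
      (∀ s y x, 0 ≤ Kw s y x) ∧ (∀ s y x, Kw s y x ≠ 0 → ∀ w ∈ linkEnds y, torusNorm (s - w) ≤ 1) ∧
      IsLinkWindowContraction (d := d) (L := L) (wilsonPlaqWeight N β) suFrobDist starWin (fun c => Kw c.1) ∧
      ∀ (s : Site d L) (x : Edge d L), x ∈ vertexStar s → ∑ y, Kw s y x ≤ ρ) :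
    ∀ μ ∈ infiniteVolumeLimitPoints (d := d) (fundamentalRep (Fin N)) β, ∀ n : ℕ, ∃ c₁ : ℝ,
      ∀ (F₁ F₂ : LGConfig d (Matrix.specialUnitaryGroup (Fin N) ℂ) → ℝ)
        (Λ₁ Λ₂ : Finset (Literature.MathematicalPhysics.QuantumLattice.ZdEdge d)) (K₁ K₂ : ℝ≥0),
        Λ₁.card ≤ n → Λ₂.card ≤ n → Disjoint Λ₁ Λ₂ →
        IsLipschitzCylinder (fundamentalRep (Fin N)) F₁ Λ₁ K₁ →
        IsLipschitzCylinder (fundamentalRep (Fin N)) F₂ Λ₂ K₂ →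
          |cov[F₁, F₂; μ]| ≤
            c₁ * Real.exp (-((1 - ρ) ^ 2 / (2 * (2 * ρ * ((2 * d : ℕ) : ℝ) + 1))) * setDistEdges Λ₁ Λ₂) *
            ((K₁ : ℝ) * K₂ + Real.sqrt (∫ U, F₁ U ^ 2 ∂μ) * Real.sqrt (∫ U, F₂ U ^ 2 ∂μ)) := by
  classical
  intro μ hμ n
  haveI : SecondCountableTopology (Matrix (Fin N) (Fin N) ℂ) :=
    inferInstanceAs (SecondCountableTopology (Fin N → Fin N → ℂ))
  haveI : SecondCountableTopology (Matrix.specialUnitaryGroup (Fin N) ℂ) :=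
    Topology.IsEmbedding.subtypeVal.secondCountableTopology
  obtain ⟨Lseq, hLmono, hμL⟩ := hμ
  haveI := hμL.1
  set κ : ℝ := (1 - ρ) ^ 2 / (2 * (2 * ρ * ((2 * d : ℕ) : ℝ) + 1)) with hκdef
  have hκ0 : 0 < κ := dimRate_pos (d := d) hρ0 hρ1
  refine ⟨4 * (2 * Real.sqrt N) ^ 2 * (n : ℝ) ^ 2 * Real.exp (3 * κ), ?_⟩
  intro F₁ F₂ Λ₁ Λ₂ K₁ K₂ h₁ h₂ _ hF₁ hF₂
  have hK₁ : (0 : ℝ) ≤ K₁ := K₁.2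
  have hK₂ : (0 : ℝ) ≤ K₂ := K₂.2
  -- the distance scale and the torus threshold
  set m : ℕ := ⌊setDistEdges Λ₁ Λ₂⌋₊ with hm
  set Dmax : ℕ := ((Λ₁ ∪ Λ₂) ×ˢ (Λ₁ ∪ Λ₂)).sup fun ab =>
    Literature.Probability.LatticeModels.Site.supNorm (ab.1.1 - ab.2.1) with hDmax
  have hDm : ∀ a ∈ Λ₁ ∪ Λ₂, ∀ b ∈ Λ₁ ∪ Λ₂,
      Literature.Probability.LatticeModels.Site.supNorm (a.1 - b.1) ≤ Dmax := fun a ha b hb =>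
    Finset.le_sup (f := fun ab : Literature.MathematicalPhysics.QuantumLattice.ZdEdge d ×
        Literature.MathematicalPhysics.QuantumLattice.ZdEdge d =>
      Literature.Probability.LatticeModels.Site.supNorm (ab.1.1 - ab.2.1)) (Finset.mk_mem_product ha hb)
  -- the torus bound along the subsequence
  set b : ℝ := 4 * (2 * Real.sqrt N) ^ 2 * Real.exp (-(κ * ((m - 2 : ℕ) : ℝ))) *
    ((Λ₁.card : ℝ) * K₁) * ((Λ₂.card : ℝ) * K₂) with hbdef
  have hle : |cov[F₁, F₂; μ]| ≤ b := by
    refine abs_cov_le_of_eventually_torus (fundamentalRep (Fin N)) hμL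
      (continuous_of_isLipschitzCylinder hF₁) (continuous_of_isLipschitzCylinder hF₂) hF₁.measurable
      hF₂.measurable hF₁.isCylinder hF₂.isCylinder (fun U => hF₁.abs_le U) (fun U => hF₂.abs_le U) ?_
    filter_upwards [eventually_ge_atTop (max L₁ (2 * Dmax))] with k hk
    have hkL : max L₁ (2 * Dmax) ≤ Lseq k := hk.trans hLmono.le_apply
    obtain ⟨Kw, hKw, hKloc, hH1, hsum⟩ := hW (Lseq k + 1) (by omega)
    -- below half the period the projection is isometric on `Λ₁ ∪ Λ₂`
    have hiso : ∀ a ∈ Λ₁ ∪ Λ₂, ∀ b ∈ Λ₁ ∪ Λ₂,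
        torusNorm ((torusEdge (Lseq k + 1) a).1 - (torusEdge (Lseq k + 1) b).1) =
          Literature.Probability.LatticeModels.Site.supNorm (a.1 - b.1) := by
      intro a ha b hb
      have hlt : 2 * Literature.Probability.LatticeModels.Site.supNorm (a.1 - b.1) < Lseq k + 1 := by
        have := hDm a ha b hb; omega
      have e : (torusEdge (Lseq k + 1) a).1 - (torusEdge (Lseq k + 1) b).1 =
          Torus.proj (Lseq k + 1) (a.1 - b.1) := by
        show Torus.proj (Lseq k + 1) a.1 - Torus.proj (Lseq k + 1) b.1 = _
        rw [sub_eq_add_neg, ← torusProj_neg_zd, ← torusProj_add_zd, ← sub_eq_add_neg]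
      rw [e]
      exact torusNorm_proj_eq hlt
    have hinj : ∀ a ∈ Λ₁ ∪ Λ₂, ∀ b ∈ Λ₁ ∪ Λ₂,
        torusEdge (Lseq k + 1) a = torusEdge (Lseq k + 1) b → a = b := by
      intro a ha b hb hab
      have h1 : (torusEdge (Lseq k + 1) a).1 = (torusEdge (Lseq k + 1) b).1 := by rw [hab]
      have h2 : a.2 = b.2 := by
        have := congrArg Prod.snd hab; exact this
      have h0 : Literature.Probability.LatticeModels.Site.supNorm (a.1 - b.1) = 0 := by
        rw [← hiso a ha b hb, h1, sub_self, torusNorm_zero]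
      have h3 : a.1 = b.1 :=
        sub_eq_zero.1 (Literature.Probability.LatticeModels.Site.supNorm_eq_zero_iff.1 h0)
      exact Prod.ext h3 h2
    have hinj₁ : ∀ e ∈ Λ₁, ∀ e' ∈ Λ₁, torusEdge (Lseq k + 1) e = torusEdge (Lseq k + 1) e' → e = e' :=
      fun e he e' he' => hinj e (Finset.mem_union_left _ he) e' (Finset.mem_union_left _ he')
    have hinj₂ : ∀ e ∈ Λ₂, ∀ e' ∈ Λ₂, torusEdge (Lseq k + 1) e = torusEdge (Lseq k + 1) e' → e = e' :=
      fun e he e' he' => hinj e (Finset.mem_union_right _ he) e' (Finset.mem_union_right _ he')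
    have hgeom : ∀ a ∈ Λ₁, ∀ b ∈ Λ₂,
        m ≤ torusNorm ((torusEdge (Lseq k + 1) a).1 - (torusEdge (Lseq k + 1) b).1) := by
      intro a ha b hb
      rw [hiso a (Finset.mem_union_left _ ha) b (Finset.mem_union_right _ hb)]
      have h := setDistEdges_le_supNorm_of_mem (Λ₁ := Λ₁) (Λ₂ := Λ₂) ha hb
      rw [hm]
      exact Nat.floor_le_of_le h
    have h := star_torus_cov_lipschitz (L := Lseq k + 1) β hρ0 hρ1 hKw hKloc hH1 hsum hF₁ hF₂
      hinj₁ hinj₂ hgeom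
    have hcov : cov[toTorusObservable (Lseq k + 1) F₁, toTorusObservable (Lseq k + 1) F₂;
        wilsonMeasure (d := d) (L := Lseq k + 1) (fundamentalRep (Fin N)) β] =
        (∫ V, toTorusObservable (Lseq k + 1) F₁ V * toTorusObservable (Lseq k + 1) F₂ V
            ∂(wilsonMeasure (d := d) (L := Lseq k + 1) (fundamentalRep (Fin N)) β)) -
          (∫ V, toTorusObservable (Lseq k + 1) F₁ V
            ∂(wilsonMeasure (d := d) (L := Lseq k + 1) (fundamentalRep (Fin N)) β)) *
            ∫ V, toTorusObservable (Lseq k + 1) F₂ V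
              ∂(wilsonMeasure (d := d) (L := Lseq k + 1) (fundamentalRep (Fin N)) β) := by
      haveI : IsProbabilityMeasure
          (wilsonMeasure (d := d) (L := Lseq k + 1) (fundamentalRep (Fin N)) β) :=
        isProbabilityMeasure_wilsonMeasure (d := d) (L := Lseq k + 1) _ (continuous_fundamentalRep (Fin N)) _
      have hfo := linkObs_toTorusObservable (L := Lseq k + 1) hF₁ hinj₁
      have hgo := linkObs_toTorusObservable (L := Lseq k + 1) hF₂ hinj₂
      obtain ⟨B₁, hB₁⟩ := hfo.bounded
      obtain ⟨B₂, hB₂⟩ := hgo.bounded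
      have l₁ : MemLp (toTorusObservable (Lseq k + 1) F₁) 2
          (wilsonMeasure (d := d) (L := Lseq k + 1) (fundamentalRep (Fin N)) β) :=
        memLp_of_bounded (a := -B₁) (b := B₁) (ae_of_all _ fun U => abs_le.1 (hB₁ U))
          hfo.measurable.aestronglyMeasurable 2
      have l₂ : MemLp (toTorusObservable (Lseq k + 1) F₂) 2
          (wilsonMeasure (d := d) (L := Lseq k + 1) (fundamentalRep (Fin N)) β) :=
        memLp_of_bounded (a := -B₂) (b := B₂) (ae_of_all _ fun U => abs_le.1 (hB₂ U))
          hgo.measurable.aestronglyMeasurable 2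
      exact covariance_eq_sub l₁ l₂
    rw [← hcov]
    exact h
  refine hle.trans ?_
  -- `b ≤ c₁ e^{-κ d} (K₁K₂ + …)`
  have hsd0 : 0 ≤ setDistEdges Λ₁ Λ₂ := setDistEdges_nonneg Λ₁ Λ₂
  have hmreal : setDistEdges Λ₁ Λ₂ - 3 ≤ ((m - 2 : ℕ) : ℝ) := by
    have hfl : setDistEdges Λ₁ Λ₂ < (m : ℝ) + 1 := by
      rw [hm]; exact Nat.lt_floor_add_one _
    by_cases hm2 : 2 ≤ m
    · rw [Nat.cast_sub hm2]; push_cast; linarith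
    · have : (m : ℝ) < 2 := by exact_mod_cast (not_le.1 hm2)
      linarith [(Nat.cast_nonneg _ : (0 : ℝ) ≤ ((m - 2 : ℕ) : ℝ))]
  have hexp : Real.exp (-(κ * ((m - 2 : ℕ) : ℝ))) ≤
      Real.exp (3 * κ) * Real.exp (-κ * setDistEdges Λ₁ Λ₂) := by
    rw [← Real.exp_add]
    refine Real.exp_le_exp.2 ?_
    nlinarith
  have hn₁ : (Λ₁.card : ℝ) ≤ n := by exact_mod_cast h₁
  have hn₂ : (Λ₂.card : ℝ) ≤ n := by exact_mod_cast h₂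
  have h4 : (0 : ℝ) ≤ 4 * (2 * Real.sqrt N) ^ 2 := by positivity
  have hL2 : 0 ≤ Real.sqrt (∫ U, F₁ U ^ 2 ∂μ) * Real.sqrt (∫ U, F₂ U ^ 2 ∂μ) := by positivity
  calc b = 4 * (2 * Real.sqrt N) ^ 2 * Real.exp (-(κ * ((m - 2 : ℕ) : ℝ))) *
        ((Λ₁.card : ℝ) * Λ₂.card) * ((K₁ : ℝ) * K₂) := by rw [hbdef]; ring
    _ ≤ 4 * (2 * Real.sqrt N) ^ 2 *
        (Real.exp (3 * κ) * Real.exp (-κ * setDistEdges Λ₁ Λ₂)) *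
        ((n : ℝ) * n) * ((K₁ : ℝ) * K₂) := by
        have hcc : (Λ₁.card : ℝ) * Λ₂.card ≤ (n : ℝ) * n :=
          mul_le_mul hn₁ hn₂ (Nat.cast_nonneg _) (Nat.cast_nonneg _)
        have hKK : (0 : ℝ) ≤ (K₁ : ℝ) * K₂ := mul_nonneg hK₁ hK₂
        exact mul_le_mul_of_nonneg_right
          (mul_le_mul (mul_le_mul_of_nonneg_left hexp h4) hcc (by positivity) (by positivity)) hKK
    _ = 4 * (2 * Real.sqrt N) ^ 2 * (n : ℝ) ^ 2 * Real.exp (3 * κ) *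
          Real.exp (-κ * setDistEdges Λ₁ Λ₂) * ((K₁ : ℝ) * K₂) := by ring
    _ ≤ 4 * (2 * Real.sqrt N) ^ 2 * (n : ℝ) ^ 2 * Real.exp (3 * κ) *
          Real.exp (-κ * setDistEdges Λ₁ Λ₂) *
          ((K₁ : ℝ) * K₂ + Real.sqrt (∫ U, F₁ U ^ 2 ∂μ) * Real.sqrt (∫ U, F₂ U ^ 2 ∂μ)) :=
        mul_le_mul_of_nonneg_left (le_add_of_nonneg_right hL2) (by positivity)

/-! ### The capstones: `MassGapAt d N x` from star windows (+ DLR uniqueness, which the windows also give) -/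

/-- **The track-(a) currency from star windows on all large tori plus DLR uniqueness** (`SU(N)`, any `d`):
at 't Hooft coupling `x` (tree coupling `N·x`), if every torus of side `L ≥ L₁` carries a star-window influence
array (four clauses, one `ρ < 1`) for the torus Wilson specification at tree coupling `N·x`, and the DLR state of
the `ℤ^d` specification at `N·x` is unique, then `Summit.Ventures.YMGap.MassGapAt d N x` (the unique DLR state
is an infinite-volume limit point, and `star_limitState_clustering` applies).  General-`d` form of
`StarSUNLimit.star_massGapAt_of_unique`. [folklore] -/
theorem star_massGapAt_of_unique (x : ℝ) {ρ : ℝ} (hρ0 : 0 ≤ ρ) (hρ1 : ρ < 1) (L₁ : ℕ)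
    (hW : ∀ (L : ℕ) [NeZero L], L₁ ≤ L → ∃ Kw : Site d L → Edge d L → Edge d L → ℝ,
      (∀ s y e, 0 ≤ Kw s y e) ∧ (∀ s y e, Kw s y e ≠ 0 → ∀ w ∈ linkEnds y, torusNorm (s - w) ≤ 1) ∧
      IsLinkWindowContraction (d := d) (L := L) (wilsonPlaqWeight N ((N : ℝ) * x)) suFrobDist starWin
        (fun c => Kw c.1) ∧
      ∀ (s : Site d L) (e : Edge d L), e ∈ vertexStar s → ∑ y, Kw s y e ≤ ρ)
    (huniq : HasUniqueGibbsMeasure (ymSpecification (d := d) (fundamentalRep (Fin N)) ((N : ℝ) * x))) :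
    MassGapAt d N x := by
  haveI : SecondCountableTopology (Matrix (Fin N) (Fin N) ℂ) :=
    inferInstanceAs (SecondCountableTopology (Fin N → Fin N → ℂ))
  haveI : SecondCountableTopology (Matrix.specialUnitaryGroup (Fin N) ℂ) :=
    Topology.IsEmbedding.subtypeVal.secondCountableTopology
  refine ⟨huniq, fun μ hμ => ?_⟩
  have hρc := continuous_fundamentalRep (Fin N)
  -- the unique DLR state is a limit point of the torus states at tree coupling `N·x`
  obtain ⟨ν, hν⟩ := infiniteVolumeLimitPoints_nonempty_holds (d := d) (fundamentalRep (Fin N)) hρc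
    ((N : ℝ) * x)
  have hνG : ν ∈ ymGibbsMeasures (d := d) (fundamentalRep (Fin N)) ((N : ℝ) * x) :=
    mem_ymGibbsMeasures_of_mem_infiniteVolumeLimitPoints_holds (d := d) (fundamentalRep (Fin N)) hρc hν
  have hμν : μ = ν := huniq.1 hμ hνG
  have hμlim : μ ∈ infiniteVolumeLimitPoints (d := d) (fundamentalRep (Fin N)) ((N : ℝ) * x) := by
    rw [hμν]; exact hν
  exact ⟨(1 - ρ) ^ 2 / (2 * (2 * ρ * ((2 * d : ℕ) : ℝ) + 1)), dimRate_pos (d := d) hρ0 hρ1, fun n =>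
    star_limitState_clustering ((N : ℝ) * x) hρ0 hρ1 L₁ hW μ hμlim n⟩

/-- **`MassGapAt d N x` FROM STAR WINDOWS ALONE** (`SU(N)`, any `d`): star-window influence arrays (four
clauses, one `ρ < 1`) on every torus of side `L ≥ L₁` for the torus Wilson specification at tree coupling
`N·x` give BOTH clauses of `MassGapAt d N x` — DLR uniqueness on `ℤ^d` from the window on the single torus of
side `max L₁ 5` through this seat's any-`d` door `DSWindowZd.hasUniqueGibbsMeasure_of_isLinkWindowContraction`
(chart `L ≥ 5`, Dobrushin–Shlosman uniqueness in infinite volume), and the covariance clause from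
`star_massGapAt_of_unique`.  This is the socket the general-`d` Lemma G rows plug into. [folklore] -/
theorem star_massGapAt_of_windows (x : ℝ) {ρ : ℝ} (hρ0 : 0 ≤ ρ) (hρ1 : ρ < 1) (L₁ : ℕ)
    (hW : ∀ (L : ℕ) [NeZero L], L₁ ≤ L → ∃ Kw : Site d L → Edge d L → Edge d L → ℝ,
      (∀ s y e, 0 ≤ Kw s y e) ∧ (∀ s y e, Kw s y e ≠ 0 → ∀ w ∈ linkEnds y, torusNorm (s - w) ≤ 1) ∧
      IsLinkWindowContraction (d := d) (L := L) (wilsonPlaqWeight N ((N : ℝ) * x)) suFrobDist starWin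
        (fun c => Kw c.1) ∧
      ∀ (s : Site d L) (e : Edge d L), e ∈ vertexStar s → ∑ y, Kw s y e ≤ ρ) :
    MassGapAt d N x := by
  haveI : NeZero (max L₁ 5) := ⟨by omega⟩
  obtain ⟨Kw, hKw, -, hH1, hsum⟩ := hW (max L₁ 5) (le_max_left _ _)
  exact star_massGapAt_of_unique x hρ0 hρ1 L₁ hW
    (DSWindowZd.hasUniqueGibbsMeasure_of_isLinkWindowContraction (N := N) (L := max L₁ 5)
      (le_max_right _ _) hρ0 hρ1 hKw hH1 hsum)

/-- **DLR uniqueness on `ℤ^d` from the windows** (`SU(N)`, any `d`, tree coupling `β`): the window on the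
single torus of side `max L₁ 5` suffices (`DSWindowZd.hasUniqueGibbsMeasure_of_isLinkWindowContraction`);
recorded in the all-tori hypothesis shape of this file for the rows. [folklore] -/
theorem star_hasUniqueGibbsMeasure_of_windows (β : ℝ) {ρ : ℝ} (hρ0 : 0 ≤ ρ) (hρ1 : ρ < 1) (L₁ : ℕ)
    (hW : ∀ (L : ℕ) [NeZero L], L₁ ≤ L → ∃ Kw : Site d L → Edge d L → Edge d L → ℝ,
      (∀ s y e, 0 ≤ Kw s y e) ∧ (∀ s y e, Kw s y e ≠ 0 → ∀ w ∈ linkEnds y, torusNorm (s - w) ≤ 1) ∧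
      IsLinkWindowContraction (d := d) (L := L) (wilsonPlaqWeight N β) suFrobDist starWin
        (fun c => Kw c.1) ∧
      ∀ (s : Site d L) (e : Edge d L), e ∈ vertexStar s → ∑ y, Kw s y e ≤ ρ) :
    HasUniqueGibbsMeasure (ymSpecification (d := d) (fundamentalRep (Fin N)) β) := by
  haveI : NeZero (max L₁ 5) := ⟨by omega⟩
  obtain ⟨Kw, hKw, -, hH1, hsum⟩ := hW (max L₁ 5) (le_max_left _ _)
  exact DSWindowZd.hasUniqueGibbsMeasure_of_isLinkWindowContraction (N := N) (L := max L₁ 5)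
    (le_max_right _ _) hρ0 hρ1 hKw hH1 hsum

/-- **The thermodynamic limit exists and is unique** (`HasUniqueInfiniteVolumeLimit`: the FULL sequence of
torus Wilson states converges on bounded continuous cylinder observables and has exactly one limit point —
Osterwalder–Seiler 1978 §4 currency), `SU(N)`, any `d`, from the windows: via the `ℤ^d` window schema
(`DSWindowZd.starWindowBoundZd_of_isLinkWindowContraction`) and
`DSWindowZd.hasUniqueInfiniteVolumeLimit_of_starWindowBoundZd`. [folklore] -/
theorem star_hasUniqueInfiniteVolumeLimit_of_windows (β : ℝ) {ρ : ℝ} (hρ0 : 0 ≤ ρ) (hρ1 : ρ < 1)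
    (L₁ : ℕ)
    (hW : ∀ (L : ℕ) [NeZero L], L₁ ≤ L → ∃ Kw : Site d L → Edge d L → Edge d L → ℝ,
      (∀ s y e, 0 ≤ Kw s y e) ∧ (∀ s y e, Kw s y e ≠ 0 → ∀ w ∈ linkEnds y, torusNorm (s - w) ≤ 1) ∧
      IsLinkWindowContraction (d := d) (L := L) (wilsonPlaqWeight N β) suFrobDist starWin
        (fun c => Kw c.1) ∧
      ∀ (s : Site d L) (e : Edge d L), e ∈ vertexStar s → ∑ y, Kw s y e ≤ ρ) :
    HasUniqueInfiniteVolumeLimit (d := d) (fundamentalRep (Fin N)) β := by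
  haveI : NeZero (max L₁ 5) := ⟨by omega⟩
  obtain ⟨Kw, hKw, -, hH1, hsum⟩ := hW (max L₁ 5) (le_max_left _ _)
  exact DSWindowZd.hasUniqueInfiniteVolumeLimit_of_starWindowBoundZd β hρ0 hρ1
    (DSWindowZd.starWindowBoundZd_of_isLinkWindowContraction (N := N) (L := max L₁ 5) (le_max_right _ _)
      suFrobDist_nonneg hKw hH1 hsum)

end Limit

end Summit.Ventures.YMGap.StarDimLimit

end
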